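import Summits.CriticalPhenomena.SAWScalingLimit.Theses.SAWPoincareChain
import Literature.Probability.RandomPlanarGeometry.RestrictionPullback
import Literature.Probability.RandomPlanarGeometry.CaratheodoryHalfPlaneProofs
import Literature.Probability.RandomPlanarGeometry.ConformalMapCaratheodoryProofs

/-!
# `SAWPoincareChain.DiscToDomains` (stmt-CriticalPhenomena-7560): transport of convergence to
SLE_{8/3} from the unit disc to every Dobrushin domain

Route `SAWPoincareChain` of `CriticalPhenomena/SAWScalingLimit`, support item `DiscToDomains`:
if a family `Q t` of chordal laws is, for all small `t > 0`, chordal and EXACTLY conformally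
covariant (`ChordalFamily.IsConformallyCovariant`), and the disc laws `Q t (𝔻; 1, −1)` converge
weakly as `t → 0⁺` to a chordal SLE_{8/3} law of `(𝔻; 1, −1)`, then for every Dobrushin domain
`(D; a, b)` the laws `Q t D` converge weakly to a chordal SLE_{8/3} law of `(D; a, b)`.

## Proof (bookkeeping over proved tree facts)

Take chordal uniformizing maps `φ : ℍ → 𝔻` and `ψ : ℍ → D`
(`MarkedDomain.exists_isChordalUniformizing_holds`: Riemann mapping + Carathéodory, proved) and
the conjugating conformal map `g = ψ ∘ φ⁻¹ : 𝔻 → D` with its continuous extension `G : ℂ → ℂ`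
(`exists_continuousMap_conj`, Carathéodory `JordanDomain.exists_continuousOn_extension_holds` +
Tietze): `G = g` on `𝔻`, `g` has boundary values `1 ↦ a`, `−1 ↦ b`. Exact covariance gives
`Q t D = G_* (Q t 𝔻)` for all small `t`; `CurveClass.map G` is continuous
(`CurveClass.continuous_map`), so for every bounded continuous `f`,
`∫ f d(Q t D) = ∫ (f ∘ G_*) d(Q t 𝔻) → ∫ (f ∘ G_*) dμ = ∫ f d(G_* μ)` (continuous mapping
theorem, Billingsley 1999 Thm. 2.7 in its trivial "composition with a continuous map" form);
and `G_* μ` is the chordal SLE_{8/3} law of `(D; a, b)`: `μ` is the law of an SLE curve `Γ` of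
`(𝔻; 1, −1)` and `G_* ∘ Γ` is an SLE curve of `(D; a, b)` for the uniformizing map `g ∘ φ_Γ`
(`IsSLECurve.map` with Carathéodory's boundary values `JordanDomain.exists_hasBoundaryValue_holds`).
No uniqueness of the SLE law is needed for this direction.

Sources: G. F. Lawler, O. Schramm, W. Werner, *On the scaling limit of planar self-avoiding
walk*, Proc. Sympos. Pure Math. 72 (2004), §2 (conformal invariance of the limit measures);
P. Billingsley, *Convergence of Probability Measures*, 2nd ed. (1999), Thm. 2.7;
G. F. Lawler, *Conformally Invariant Processes in the Plane* (2005), §6.3.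
-/

namespace Summit.CriticalPhenomena.SAWScalingLimit.Theorems

open MeasureTheory Filter Topology Set
open Literature.Probability.RandomPlanarGeometry

/-- **Continuous mapping for `TendstoLaw` of laws on curve classes.** If the laws `P t` on
`CurveClass ℂ` converge weakly to `μ` as `t → 0⁺` (in the `TendstoLaw` form with the identity
random variable), then their push-forwards along `CurveClass.map G`, `G : ℂ → ℂ` continuous,
converge weakly to the push-forward of `μ` (Billingsley 1999, Thm. 2.7, for a continuous map:
`f ∘ G_*` is again bounded continuous). -/
theorem tendstoLaw_id_map_curveClassMap {P : ℝ → Measure (CurveClass ℂ)}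
    {μ : Measure (CurveClass ℂ)} (G : C(ℂ, ℂ))
    (h : TendstoLaw (fun (_ : ℝ) (x : CurveClass ℂ) => x) P id μ) :
    TendstoLaw (fun (_ : ℝ) (x : CurveClass ℂ) => x) (fun t => (P t).map (CurveClass.map G)) id
      (μ.map (CurveClass.map G)) := by
  intro f
  have hGc : Continuous (CurveClass.map G) := CurveClass.continuous_map G
  have hGm : AEMeasurable (CurveClass.map G) μ := (CurveClass.measurable_map G).aemeasurable
  set fG : BoundedContinuousFunction (CurveClass ℂ) ℝ := f.compContinuous ⟨CurveClass.map G, hGc⟩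
    with hfG
  have hlim := h fG
  simp only [id] at hlim ⊢
  rw [integral_map hGm f.continuous.aestronglyMeasurable]
  refine hlim.congr fun t => ?_
  rw [integral_map (CurveClass.measurable_map G).aemeasurable f.continuous.aestronglyMeasurable]
  rfl

/-- **`SAWPoincareChain.DiscToDomains` (stmt-CriticalPhenomena-7560) holds**: transport of weak
convergence to chordal SLE_{8/3} from `(𝔻; 1, −1)` to every Dobrushin domain `(D; a, b)` for an
eventually chordal, exactly conformally covariant family `Q t` — via the conformal map
`g = ψ ∘ φ⁻¹ : 𝔻 → D` between chordal uniformizations, its continuous extension `G`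
(Carathéodory + Tietze, `exists_continuousMap_conj`), exact covariance `Q t D = G_* (Q t 𝔻)`,
continuity of `CurveClass.map G`, and the SLE transport `IsSLECurve.map`.
Lawler–Schramm–Werner (2004) §2; Billingsley (1999) Thm. 2.7; Lawler (2005) §6.3. -/
theorem DiscToDomains_proof :
    Summit.CriticalPhenomena.SAWScalingLimit.Theses.SAWPoincareChain.DiscToDomains := by
  unfold Summit.CriticalPhenomena.SAWScalingLimit.Theses.SAWPoincareChain.DiscToDomains
  intro Q hQ hdisc D
  obtain ⟨μ, hμSLE, hμlim⟩ := hdisc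
  -- chordal uniformizing maps of the disc and of `D`, and the conjugating map with its extension
  obtain ⟨φ, hφ⟩ := MarkedDomain.exists_isChordalUniformizing_holds DobrushinDomain.unitDisc
  obtain ⟨ψ, hψ⟩ := MarkedDomain.exists_isChordalUniformizing_holds D
  obtain ⟨G, hGg, hb0, hb1, -, -, -, -, -⟩ :=
    exists_continuousMap_conj JordanDomain.exists_continuousOn_extension_holds hφ hψ
  refine ⟨μ.map (CurveClass.map G), ?_, ?_⟩
  · -- the image law is the SLE_{8/3} law of `D`
    obtain ⟨Γ, hΓ, rfl⟩ := hμSLE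
    rw [AEMeasurable.map_map_of_aemeasurable (CurveClass.measurable_map G).aemeasurable
      hΓ.aemeasurable]
    exact (hΓ.map JordanDomain.exists_hasBoundaryValue_holds (φ.symm.trans ψ) hb0 hb1
      hGg).isSLELaw_map
  · -- convergence: `Q t D = G_* (Q t 𝔻)` eventually, and continuous mapping
    have hev : ∀ᶠ t in 𝓝[>] (0 : ℝ), Q t D =
        (Q t DobrushinDomain.unitDisc).map (CurveClass.map G) :=
      hQ.mono fun t ht => ht.2 DobrushinDomain.unitDisc D (φ.symm.trans ψ) G hb0 hb1 hGg
    have hmap := tendstoLaw_id_map_curveClassMap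
      (P := fun t => Q t DobrushinDomain.unitDisc) G hμlim
    intro f
    refine (hmap f).congr' ?_
    filter_upwards [hev] with t ht
    rw [ht]

end Summit.CriticalPhenomena.SAWScalingLimit.Theorems
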